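import Summits.SmoothPoincare4.SmoothPoincare4.Theorems.SullivanDualTargetHelperConformalJacketOfChartForm
import Summits.SmoothPoincare4.SmoothPoincare4.Theorems.SullivanDualTarget
import Summits.SmoothPoincare4.SmoothPoincare4.Theorems.SullivanDualTargetIffSummit
import Literature.Geometry.Symplectic.GromovR4StdModel
import Summits.SmoothPoincare4.SmoothPoincare4.Theorems.SymplecticOrigamiSchsplitCerfStubConePullbackLiouville

/-!
# SmoothPoincare4 / SullivanDual — crux `Target` (stmt-SmoothPoincare4-7823), line `kaehler-jacket`:
# CERTIFICATE for the v1 apex `stub_tightInnerSphere` — it holds whenever `Σ ∖ p` has a chart-form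
# diffeomorphism onto `ℝ⁴` (lead c6)

`helper_tightInnerSphereOfChartForm` (registered): from a chart-form diffeomorphism `Φ` of
`Σ ∖ p` (for `Σ ≅ S⁴`: Palais, `palais_puncturedSphere_chartForm_holds`) we produce VERBATIM the
data of the skeleton's apex `stub_tightInnerSphere` at `(Σ, p)`: the conformal jacket
`F = A⁻¹ (e_q − c)` near `q := Φ⁻¹ 0` of `helper_conformalJacketOfChartForm`, radii
`μ = r₁/2 < μ' = 3r₁/4`, width `δ = r₁/4`, the LIOUVILLE FORM `α := F^*λ₀`
(`λ₀ = -¼ α₀ = ½ ω₀(y, dy)`, the tree's `fun w => (-(4:ℝ)⁻¹) • ambAlpha w`, with `dλ₀ = ω₀`: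
`SullivanDual.mextDeriv_liouville_eq_stdSymplecticMForm`), the Liouville field `Z` defined by
`dF (Z x) = ½ F x` (it exists since `dF_x` is bijective), the isometry `A` and the constant
`u ≡ 2 log μ`.  Then (PRIM) `dα = F^*ω₀` everywhere (naturality of `d`), (DUAL)
`ω₀(dF Z, dF w) = ½ ω₀(F x, dF w) = α(w)` everywhere, (OUT) `De Z = ½ (e − c)` on the conformal
zone, so `⟪De Z, e x − c⟫ = ½ μ² > 0` on the sphere, and (TEXT) `α_x(v) = ½ ω₀(A⁻¹(e x − c),
A⁻¹ De v) = μ² · ½ ω₀(θ, A⁻¹ μ⁻¹ De v)` with `e^{u} = μ²`.  Corollaries: the v1 apex holds at every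
puncture of every `Σ ≅ S⁴` (unconditional) and follows from the matrix of `Target` at `(Σ, p)`
given `GromovChartForm` — so, together with the skeleton's `Target_of` (v1 apex ∧ Liouville
collar ⇒ ball extension ⇒ standard end ⇒ door), the planner's apex is the crux in contact
clothing.

References: H. Geiges, *An Introduction to Contact Topology* (2008), Lemma/Definition 1.4.5 and
Lemma 5.2.4 [Geiges2008]; R. S. Palais, Proc. AMS 11 (1960), Thm. B [Palais1960].
-/

noncomputable section

set_option linter.dupNamespace false

open scoped Manifold ContDiff Topology
open Set Function Filter Metric
open Literature.Geometry.Kaehler (MForm IsSmoothForm IsClosedForm mextDeriv)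
open Literature.Geometry.Symplectic (punctured InPuncturedChartBall stdSymplecticForm inversion
  invertedStdForm IsSymplecticStandardNearPoint AgreesWithInvertedChartNear ambAlpha
  ambAlpha_apply stdComplexStructure stdSymplecticMForm stdSymplecticMForm_pullback_apply
  isSmoothForm_stdSymplecticMForm palais_puncturedSphere_chartForm_holds)
open Literature.Topology.FourManifolds (HomotopySphere)
open Summit.SmoothPoincare4.SmoothPoincare4.Theses.SullivanDual (GromovChartForm)

namespace Summit.SmoothPoincare4.SmoothPoincare4.Theorems.Target.KaehlerJacket

local notation "E4" => EuclideanSpace ℝ (Fin 4)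
local notation "𝕊⁴" => Metric.sphere (0 : EuclideanSpace ℝ (Fin 5)) 1

/-- The Liouville form `λ₀ = -¼ α₀` of `ℝ⁴` evaluates to `½ ω₀(w, v)`. [folklore] -/
theorem liouville_apply (w v : E4) :
    ((-(4 : ℝ)⁻¹) • ambAlpha w) ![v] = 2⁻¹ * stdSymplecticForm w v := by
  rw [ContinuousAlternatingMap.smul_apply, ambAlpha_apply, smul_eq_mul]
  have h0 : (![v] : Fin 1 → E4) 0 = v := rfl
  rw [h0, Literature.Geometry.Symplectic.inner_stdComplexStructure_right,
    Summit.SmoothPoincare4.SmoothPoincare4.Theorems.SullivanDual.inner_stdComplexStructure_eq_stdSymplecticForm]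
  ring

/-- **Registered helper `helper_tightInnerSphereOfChartForm`**: a chart-form diffeomorphism of
`Σ ∖ p` yields the data of the v1 apex `stub_tightInnerSphere` at `(Σ, p)` (see the module
docstring). [cite: Geiges2008, Lemma/Definition 1.4.5] -/
theorem helper_tightInnerSphereOfChartForm :
    ∀ (S : HomotopySphere 4) (p : S.carrier) (Φ : (punctured p) ≃ₘ⟮𝓡 4, 𝓡 4⟯ E4),
      AgreesWithInvertedChartNear p Φ →
      ∃ q : S.carrier, q ≠ p ∧
      ∃ (F : punctured p → E4) (μ μ' δ : ℝ) (α : MForm (𝓡 4) (punctured p) ℝ 1)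
        (Z : ∀ x : punctured p, TangentSpace (𝓡 4) x) (A : E4 ≃ₗᵢ[ℝ] E4) (u : E4 → ℝ),
        (∀ x : punctured p, x.1 ≠ q →
          ContMDiffAt (𝓡 4) 𝓘(ℝ, E4) ∞ F x ∧ Injective (mfderiv (𝓡 4) 𝓘(ℝ, E4) F x)) ∧
        AgreesWithInvertedChartNear p F ∧
        0 < μ ∧ μ < μ' ∧ 0 < δ ∧
        Metric.closedBall (extChartAt (𝓡 4) q q) μ' ⊆ (extChartAt (𝓡 4) q).target ∧
        (∀ y ∈ Metric.closedBall (extChartAt (𝓡 4) q q) μ', (extChartAt (𝓡 4) q).symm y ≠ p) ∧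
        IsSmoothForm α ∧ ContDiff ℝ ∞ u ∧
        (∀ x : punctured p, x.1 ∈ (chartAt E4 q).source →
          |‖extChartAt (𝓡 4) q x.1 - extChartAt (𝓡 4) q q‖ - μ| < δ →
          ∀ v w : TangentSpace (𝓡 4) x, mextDeriv α x ![v, w] =
            stdSymplecticForm (mfderiv (𝓡 4) 𝓘(ℝ, E4) F x v) (mfderiv (𝓡 4) 𝓘(ℝ, E4) F x w)) ∧
        (∀ x : punctured p, x.1 ∈ (chartAt E4 q).source →
          |‖extChartAt (𝓡 4) q x.1 - extChartAt (𝓡 4) q q‖ - μ| < δ →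
          ∀ w : TangentSpace (𝓡 4) x,
            stdSymplecticForm (mfderiv (𝓡 4) 𝓘(ℝ, E4) F x (Z x)) (mfderiv (𝓡 4) 𝓘(ℝ, E4) F x w) =
              α x ![w]) ∧
        (∀ x : punctured p, x.1 ∈ (chartAt E4 q).source →
          ‖extChartAt (𝓡 4) q x.1 - extChartAt (𝓡 4) q q‖ = μ →
          0 < @inner ℝ E4 _ (mfderiv (𝓡 4) 𝓘(ℝ, E4) (fun z : punctured p => extChartAt (𝓡 4) q z.1) x (Z x))
            (extChartAt (𝓡 4) q x.1 - extChartAt (𝓡 4) q q)) ∧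
        (∀ x : punctured p, x.1 ∈ (chartAt E4 q).source →
          ‖extChartAt (𝓡 4) q x.1 - extChartAt (𝓡 4) q q‖ = μ →
          ∀ v : TangentSpace (𝓡 4) x,
            @inner ℝ E4 _ (mfderiv (𝓡 4) 𝓘(ℝ, E4) (fun z : punctured p => extChartAt (𝓡 4) q z.1) x v)
              (extChartAt (𝓡 4) q x.1 - extChartAt (𝓡 4) q q) = 0 →
            α x ![v] =
              Real.exp (u (A.symm (μ⁻¹ • (extChartAt (𝓡 4) q x.1 - extChartAt (𝓡 4) q q)))) *
                (1 / 2 * stdSymplecticForm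
                  (A.symm (μ⁻¹ • (extChartAt (𝓡 4) q x.1 - extChartAt (𝓡 4) q q)))
                  (A.symm (μ⁻¹ • (mfderiv (𝓡 4) 𝓘(ℝ, E4)
                    (fun z : punctured p => extChartAt (𝓡 4) q z.1) x v : E4))))) := by
  intro S p Φ hΦ
  classical
  obtain ⟨q, hq, F, A, r₁, hr₁, hFsm, hFinj, hFp, hballr₁, havoidr₁, hconf⟩ :=
    helper_conformalJacketOfChartForm S p Φ hΦ
  set e := extChartAt (𝓡 4) q with he
  set c : E4 := e q with hc
  set xq : punctured p := ⟨q, Literature.Geometry.Symplectic.mem_punctured.2 hq⟩ with hxq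
  set ch := chartAt E4 xq with hch
  have hch_apply : ∀ z : punctured p, ch z = e z.1 := fun z => rfl
  have hch_source : ∀ z : punctured p, z ∈ ch.source ↔ z.1 ∈ (chartAt E4 q).source := fun z => by
    rw [hch, TopologicalSpace.Opens.chartAt_eq, OpenPartialHomeomorph.subtypeRestr_source]
    rfl
  -- the Liouville form `α := F^*λ₀` and the Liouville field `Z` (`dF Z = ½ F`)
  set lam : MForm (𝓡 4) E4 ℝ 1 := fun w => (-(4 : ℝ)⁻¹) • ambAlpha w with hlam
  have hlam_s : IsSmoothForm lam :=
    Summit.SmoothPoincare4.SmoothPoincare4.Theorems.SullivanDual.isSmoothForm_liouville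
  have hlam_d : mextDeriv lam = stdSymplecticMForm :=
    Summit.SmoothPoincare4.SmoothPoincare4.Theorems.SullivanDual.mextDeriv_liouville_eq_stdSymplecticMForm
  set α : MForm (𝓡 4) (punctured p) ℝ 1 := lam.pullback (𝓡 4) F with hα
  have hαs : IsSmoothForm α := Literature.NumberTheory.Transcendental.isSmoothForm_pullback hFsm hlam_s
  have hα_apply : ∀ (x : punctured p) (w : TangentSpace (𝓡 4) x),
      α x ![w] = 2⁻¹ * stdSymplecticForm (F x) (mfderiv (𝓡 4) 𝓘(ℝ, E4) F x w) := by
    intro x w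
    show lam.pullback (𝓡 4) F x ![w] = _
    rw [MForm.pullback_apply]
    have h : (fun i => mfderiv (𝓡 4) 𝓘(ℝ, E4) F x ((![w] : Fin 1 → TangentSpace (𝓡 4) x) i)) =
        ![mfderiv (𝓡 4) 𝓘(ℝ, E4) F x w] := by
      funext i
      fin_cases i
      rfl
    rw [h]
    exact liouville_apply (F x) _
  have hdα : ∀ (x : punctured p) (v w : TangentSpace (𝓡 4) x), mextDeriv α x ![v, w] =
      stdSymplecticForm (mfderiv (𝓡 4) 𝓘(ℝ, E4) F x v) (mfderiv (𝓡 4) 𝓘(ℝ, E4) F x w) := by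
    intro x v w
    show mextDeriv (lam.pullback (𝓡 4) F) x ![v, w] = _
    rw [Literature.Geometry.Kaehler.mextDeriv_pullback_apply (Eventually.of_forall fun z => hFsm z)
      (hlam_s (F x)), hlam_d]
    exact stdSymplecticMForm_pullback_apply F x v w
  have hZex : ∀ x : punctured p, ∃ v : E4, mfderiv (𝓡 4) 𝓘(ℝ, E4) F x v = (2 : ℝ)⁻¹ • F x := by
    intro x
    obtain ⟨L, hL⟩ : ∃ L : E4 →L[ℝ] E4, ∀ v, L v = mfderiv (𝓡 4) 𝓘(ℝ, E4) F x v := ⟨_, fun _ => rfl⟩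
    have hinj : Injective L := fun v w h => hFinj x (by rw [← hL, ← hL]; exact h)
    obtain ⟨v, hv⟩ := (LinearMap.surjective_of_injective (f := (L : E4 →ₗ[ℝ] E4)) hinj) ((2 : ℝ)⁻¹ • F x)
    exact ⟨v, by rw [← hL]; exact hv⟩
  set Z : ∀ x : punctured p, TangentSpace (𝓡 4) x := fun x => Classical.choose (hZex x) with hZ
  have hZspec : ∀ x : punctured p, mfderiv (𝓡 4) 𝓘(ℝ, E4) F x (Z x) = (2 : ℝ)⁻¹ • F x := fun x =>
    Classical.choose_spec (hZex x)
  -- the derivative of `F` on the conformal zone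
  have hFderiv : ∀ x : punctured p, x.1 ∈ (chartAt E4 q).source → ‖e x.1 - c‖ < r₁ →
      ∀ v : TangentSpace (𝓡 4) x, mfderiv (𝓡 4) 𝓘(ℝ, E4) F x v =
        A.symm (mfderiv (𝓡 4) 𝓘(ℝ, E4) (fun z : punctured p => e z.1) x v) := by
    intro x hxs hlt v
    have hxs' : x ∈ ch.source := (hch_source x).2 hxs
    have hWopen : IsOpen (ch.source ∩ ch ⁻¹' Metric.ball c r₁) := ch.isOpen_inter_preimage Metric.isOpen_ball
    have hxW : x ∈ ch.source ∩ ch ⁻¹' Metric.ball c r₁ :=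
      ⟨hxs', by rw [Set.mem_preimage, Metric.mem_ball, dist_eq_norm]; exact hlt⟩
    have hev : F =ᶠ[𝓝 x] fun z : punctured p => A.symm (e z.1 - c) := by
      refine Filter.eventuallyEq_of_mem (hWopen.mem_nhds hxW) fun z hz => ?_
      have hz2 := hz.2
      rw [Set.mem_preimage, Metric.mem_ball, dist_eq_norm] at hz2
      exact hconf z ((hch_source z).1 hz.1) hz2
    have hA : HasFDerivAt (fun y : E4 => A.symm (y - c)) (A.symm.toContinuousLinearEquiv : E4 →L[ℝ] E4) (e x.1) := by
      have h1 : HasFDerivAt (fun y : E4 => (A.symm y : E4)) (A.symm.toContinuousLinearEquiv : E4 →L[ℝ] E4) (e x.1 - c) :=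
        A.symm.toContinuousLinearEquiv.hasFDerivAt
      have h2 := h1.comp (e x.1) ((hasFDerivAt_id (e x.1)).sub_const c)
      rwa [ContinuousLinearMap.comp_id] at h2
    have hch_d : HasMFDerivAt (𝓡 4) 𝓘(ℝ, E4) ch x (mfderiv (𝓡 4) 𝓘(ℝ, E4) ch x) :=
      ((mdifferentiable_chart xq).mdifferentiableAt hxs').hasMFDerivAt
    have hcomp : (fun z : punctured p => A.symm (e z.1 - c)) = (fun y : E4 => A.symm (y - c)) ∘ ch := rfl
    have hd : HasMFDerivAt (𝓡 4) 𝓘(ℝ, E4) (fun z : punctured p => A.symm (e z.1 - c)) x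
        ((A.symm.toContinuousLinearEquiv : E4 →L[ℝ] E4).comp (mfderiv (𝓡 4) 𝓘(ℝ, E4) ch x)) := by
      rw [hcomp]
      exact hA.hasMFDerivAt.comp x hch_d
    rw [hev.mfderiv_eq, hd.mfderiv]
    rfl
  -- radii
  set μ : ℝ := r₁ / 2 with hμ
  set μ' : ℝ := 3 * r₁ / 4 with hμ'
  have hμpos : 0 < μ := by positivity
  have hμμ' : μ < μ' := by rw [hμ, hμ']; linarith
  have hμ'r₁ : μ' ≤ r₁ := by rw [hμ']; linarith
  have hshell : ∀ x : punctured p, |‖e x.1 - c‖ - μ| < r₁ / 4 → ‖e x.1 - c‖ < r₁ := by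
    intro x hxa
    have := (abs_lt.1 hxa).2
    rw [hμ] at this
    linarith
  -- assemble
  refine ⟨q, hq, F, μ, μ', r₁ / 4, α, Z, A, fun _ => 2 * Real.log μ, ?_, hFp, hμpos, hμμ', by positivity,
    (Metric.closedBall_subset_closedBall hμ'r₁).trans hballr₁,
    fun y hy => havoidr₁ y (Metric.closedBall_subset_closedBall hμ'r₁ hy), hαs, contDiff_const,
    ?_, ?_, ?_, ?_⟩
  · -- jacket: immersion off `q` (indeed everywhere)
    intro x _
    exact ⟨hFsm x, hFinj x⟩
  · -- (PRIM) `dα = F^*ω₀`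
    intro x _ _ v w
    exact hdα x v w
  · -- (DUAL) `ω₀(dF Z, dF w) = α(w)`
    intro x _ _ w
    rw [hZspec x, hα_apply x w,
      Summit.SmoothPoincare4.SmoothPoincare4.Theorems.SchsplitCerf.ContactIsotopyGromovCone.ConePullbackLiouville.omega_smul_left]
  · -- (OUT) `⟪De Z, e x − c⟫ = ½ ‖e x − c‖² > 0` on the sphere
    intro x hxs hxμ
    have hlt : ‖e x.1 - c‖ < r₁ := by rw [hxμ, hμ]; linarith
    have h1 := hZspec x
    rw [hFderiv x hxs hlt (Z x), hconf x hxs hlt, ← map_smul] at h1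
    have h2 : mfderiv (𝓡 4) 𝓘(ℝ, E4) (fun z : punctured p => e z.1) x (Z x) = (2 : ℝ)⁻¹ • (e x.1 - c) :=
      A.symm.injective h1
    rw [h2, real_inner_smul_left, real_inner_self_eq_norm_sq, hxμ]
    positivity
  · -- (TEXT) `α|TS = e^{u} α₀` through `θ = A⁻¹(μ⁻¹(e x − c))`, `e^{u} = μ²`
    intro x hxs hxμ v _
    have hlt : ‖e x.1 - c‖ < r₁ := by rw [hxμ, hμ]; linarith
    rw [hα_apply x v, hFderiv x hxs hlt v, hconf x hxs hlt]
    have hexp : Real.exp (2 * Real.log μ) = μ * μ := by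
      rw [show (2 : ℝ) * Real.log μ = Real.log μ + Real.log μ by ring, Real.exp_add, Real.exp_log hμpos]
    set w : E4 := mfderiv (𝓡 4) 𝓘(ℝ, E4) (fun z : punctured p => e z.1) x v with hw
    set a : E4 := e x.1 - c with ha
    rw [hexp, A.symm.map_smul]
    show 2⁻¹ * stdSymplecticForm (A.symm a) (A.symm w) =
      μ * μ * (1 / 2 * stdSymplecticForm (μ⁻¹ • A.symm a) (A.symm ((μ⁻¹ : ℝ) • (w : E4))))
    rw [A.symm.map_smul,
      Summit.SmoothPoincare4.SmoothPoincare4.Theorems.SchsplitCerf.ContactIsotopyGromovCone.ConePullbackLiouville.omega_smul_left,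
      Summit.SmoothPoincare4.SmoothPoincare4.Theorems.SchsplitCerf.ContactIsotopyGromovCone.ConePullbackLiouville.omega_smul_right]
    field_simp

/-! ## Corollaries: the v1 apex is the crux in contact clothing -/

/-- **`Σ ≅ S⁴` ⇒ the v1 apex at every puncture** (unconditional; Palais' chart form).
[cite: Palais1960, Thm. B] -/
theorem tightInnerSphereAt_of_nonempty_diffeomorph_sphere (S : HomotopySphere 4)
    (hS : Nonempty (S.carrier ≃ₘ⟮𝓡 4, 𝓡 4⟯ 𝕊⁴)) (p : S.carrier) :
      ∃ q : S.carrier, q ≠ p ∧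
      ∃ (F : punctured p → E4) (μ μ' δ : ℝ) (α : MForm (𝓡 4) (punctured p) ℝ 1)
        (Z : ∀ x : punctured p, TangentSpace (𝓡 4) x) (A : E4 ≃ₗᵢ[ℝ] E4) (u : E4 → ℝ),
        (∀ x : punctured p, x.1 ≠ q →
          ContMDiffAt (𝓡 4) 𝓘(ℝ, E4) ∞ F x ∧ Injective (mfderiv (𝓡 4) 𝓘(ℝ, E4) F x)) ∧
        AgreesWithInvertedChartNear p F ∧
        0 < μ ∧ μ < μ' ∧ 0 < δ ∧
        Metric.closedBall (extChartAt (𝓡 4) q q) μ' ⊆ (extChartAt (𝓡 4) q).target ∧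
        (∀ y ∈ Metric.closedBall (extChartAt (𝓡 4) q q) μ', (extChartAt (𝓡 4) q).symm y ≠ p) ∧
        IsSmoothForm α ∧ ContDiff ℝ ∞ u ∧
        (∀ x : punctured p, x.1 ∈ (chartAt E4 q).source →
          |‖extChartAt (𝓡 4) q x.1 - extChartAt (𝓡 4) q q‖ - μ| < δ →
          ∀ v w : TangentSpace (𝓡 4) x, mextDeriv α x ![v, w] =
            stdSymplecticForm (mfderiv (𝓡 4) 𝓘(ℝ, E4) F x v) (mfderiv (𝓡 4) 𝓘(ℝ, E4) F x w)) ∧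
        (∀ x : punctured p, x.1 ∈ (chartAt E4 q).source →
          |‖extChartAt (𝓡 4) q x.1 - extChartAt (𝓡 4) q q‖ - μ| < δ →
          ∀ w : TangentSpace (𝓡 4) x,
            stdSymplecticForm (mfderiv (𝓡 4) 𝓘(ℝ, E4) F x (Z x)) (mfderiv (𝓡 4) 𝓘(ℝ, E4) F x w) =
              α x ![w]) ∧
        (∀ x : punctured p, x.1 ∈ (chartAt E4 q).source →
          ‖extChartAt (𝓡 4) q x.1 - extChartAt (𝓡 4) q q‖ = μ →
          0 < @inner ℝ E4 _ (mfderiv (𝓡 4) 𝓘(ℝ, E4) (fun z : punctured p => extChartAt (𝓡 4) q z.1) x (Z x))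
            (extChartAt (𝓡 4) q x.1 - extChartAt (𝓡 4) q q)) ∧
        (∀ x : punctured p, x.1 ∈ (chartAt E4 q).source →
          ‖extChartAt (𝓡 4) q x.1 - extChartAt (𝓡 4) q q‖ = μ →
          ∀ v : TangentSpace (𝓡 4) x,
            @inner ℝ E4 _ (mfderiv (𝓡 4) 𝓘(ℝ, E4) (fun z : punctured p => extChartAt (𝓡 4) q z.1) x v)
              (extChartAt (𝓡 4) q x.1 - extChartAt (𝓡 4) q q) = 0 →
            α x ![v] =
              Real.exp (u (A.symm (μ⁻¹ • (extChartAt (𝓡 4) q x.1 - extChartAt (𝓡 4) q q)))) *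
                (1 / 2 * stdSymplecticForm
                  (A.symm (μ⁻¹ • (extChartAt (𝓡 4) q x.1 - extChartAt (𝓡 4) q q)))
                  (A.symm (μ⁻¹ • (mfderiv (𝓡 4) 𝓘(ℝ, E4)
                    (fun z : punctured p => extChartAt (𝓡 4) q z.1) x v : E4))))) := by
  obtain ⟨Φ, hΦ⟩ := palais_puncturedSphere_chartForm_holds S.carrier p hS
  exact helper_tightInnerSphereOfChartForm S p Φ hΦ

/-- **A symplectic form standard near `p` ⇒ the v1 apex at `(Σ, p)`**, given `GromovChartForm`.
[cite: Gromov1985, §0.3.C] -/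
theorem tightInnerSphereAt_of_isSymplecticStandardNearPoint (hG : GromovChartForm)
    (S : HomotopySphere 4) (p : S.carrier) {ε : ℝ} {sf : MForm (𝓡 4) (punctured p) ℝ 2}
    (hsf : IsSymplecticStandardNearPoint p ε sf) :
      ∃ q : S.carrier, q ≠ p ∧
      ∃ (F : punctured p → E4) (μ μ' δ : ℝ) (α : MForm (𝓡 4) (punctured p) ℝ 1)
        (Z : ∀ x : punctured p, TangentSpace (𝓡 4) x) (A : E4 ≃ₗᵢ[ℝ] E4) (u : E4 → ℝ),
        (∀ x : punctured p, x.1 ≠ q →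
          ContMDiffAt (𝓡 4) 𝓘(ℝ, E4) ∞ F x ∧ Injective (mfderiv (𝓡 4) 𝓘(ℝ, E4) F x)) ∧
        AgreesWithInvertedChartNear p F ∧
        0 < μ ∧ μ < μ' ∧ 0 < δ ∧
        Metric.closedBall (extChartAt (𝓡 4) q q) μ' ⊆ (extChartAt (𝓡 4) q).target ∧
        (∀ y ∈ Metric.closedBall (extChartAt (𝓡 4) q q) μ', (extChartAt (𝓡 4) q).symm y ≠ p) ∧
        IsSmoothForm α ∧ ContDiff ℝ ∞ u ∧
        (∀ x : punctured p, x.1 ∈ (chartAt E4 q).source →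
          |‖extChartAt (𝓡 4) q x.1 - extChartAt (𝓡 4) q q‖ - μ| < δ →
          ∀ v w : TangentSpace (𝓡 4) x, mextDeriv α x ![v, w] =
            stdSymplecticForm (mfderiv (𝓡 4) 𝓘(ℝ, E4) F x v) (mfderiv (𝓡 4) 𝓘(ℝ, E4) F x w)) ∧
        (∀ x : punctured p, x.1 ∈ (chartAt E4 q).source →
          |‖extChartAt (𝓡 4) q x.1 - extChartAt (𝓡 4) q q‖ - μ| < δ →
          ∀ w : TangentSpace (𝓡 4) x,
            stdSymplecticForm (mfderiv (𝓡 4) 𝓘(ℝ, E4) F x (Z x)) (mfderiv (𝓡 4) 𝓘(ℝ, E4) F x w) =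
              α x ![w]) ∧
        (∀ x : punctured p, x.1 ∈ (chartAt E4 q).source →
          ‖extChartAt (𝓡 4) q x.1 - extChartAt (𝓡 4) q q‖ = μ →
          0 < @inner ℝ E4 _ (mfderiv (𝓡 4) 𝓘(ℝ, E4) (fun z : punctured p => extChartAt (𝓡 4) q z.1) x (Z x))
            (extChartAt (𝓡 4) q x.1 - extChartAt (𝓡 4) q q)) ∧
        (∀ x : punctured p, x.1 ∈ (chartAt E4 q).source →
          ‖extChartAt (𝓡 4) q x.1 - extChartAt (𝓡 4) q q‖ = μ →
          ∀ v : TangentSpace (𝓡 4) x,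
            @inner ℝ E4 _ (mfderiv (𝓡 4) 𝓘(ℝ, E4) (fun z : punctured p => extChartAt (𝓡 4) q z.1) x v)
              (extChartAt (𝓡 4) q x.1 - extChartAt (𝓡 4) q q) = 0 →
            α x ![v] =
              Real.exp (u (A.symm (μ⁻¹ • (extChartAt (𝓡 4) q x.1 - extChartAt (𝓡 4) q q)))) *
                (1 / 2 * stdSymplecticForm
                  (A.symm (μ⁻¹ • (extChartAt (𝓡 4) q x.1 - extChartAt (𝓡 4) q q)))
                  (A.symm (μ⁻¹ • (mfderiv (𝓡 4) 𝓘(ℝ, E4)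
                    (fun z : punctured p => extChartAt (𝓡 4) q z.1) x v : E4))))) :=
  tightInnerSphereAt_of_nonempty_diffeomorph_sphere S
    (Summit.SmoothPoincare4.SmoothPoincare4.Theorems.gromovChartForm_iff_forall_nonempty_diffeomorph_sphere.1
      hG S p ε sf hsf) p

/-- **`SmoothPoincare4` ⇒ the v1 apex everywhere** (unconditional). [cite: Palais1960, Thm. B] -/
theorem forall_tightInnerSphereAt_of_smoothPoincare4 (h : _root_.SmoothPoincare4)
    (S : HomotopySphere 4) (p : S.carrier) :
      ∃ q : S.carrier, q ≠ p ∧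
      ∃ (F : punctured p → E4) (μ μ' δ : ℝ) (α : MForm (𝓡 4) (punctured p) ℝ 1)
        (Z : ∀ x : punctured p, TangentSpace (𝓡 4) x) (A : E4 ≃ₗᵢ[ℝ] E4) (u : E4 → ℝ),
        (∀ x : punctured p, x.1 ≠ q →
          ContMDiffAt (𝓡 4) 𝓘(ℝ, E4) ∞ F x ∧ Injective (mfderiv (𝓡 4) 𝓘(ℝ, E4) F x)) ∧
        AgreesWithInvertedChartNear p F ∧
        0 < μ ∧ μ < μ' ∧ 0 < δ ∧
        Metric.closedBall (extChartAt (𝓡 4) q q) μ' ⊆ (extChartAt (𝓡 4) q).target ∧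
        (∀ y ∈ Metric.closedBall (extChartAt (𝓡 4) q q) μ', (extChartAt (𝓡 4) q).symm y ≠ p) ∧
        IsSmoothForm α ∧ ContDiff ℝ ∞ u ∧
        (∀ x : punctured p, x.1 ∈ (chartAt E4 q).source →
          |‖extChartAt (𝓡 4) q x.1 - extChartAt (𝓡 4) q q‖ - μ| < δ →
          ∀ v w : TangentSpace (𝓡 4) x, mextDeriv α x ![v, w] =
            stdSymplecticForm (mfderiv (𝓡 4) 𝓘(ℝ, E4) F x v) (mfderiv (𝓡 4) 𝓘(ℝ, E4) F x w)) ∧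
        (∀ x : punctured p, x.1 ∈ (chartAt E4 q).source →
          |‖extChartAt (𝓡 4) q x.1 - extChartAt (𝓡 4) q q‖ - μ| < δ →
          ∀ w : TangentSpace (𝓡 4) x,
            stdSymplecticForm (mfderiv (𝓡 4) 𝓘(ℝ, E4) F x (Z x)) (mfderiv (𝓡 4) 𝓘(ℝ, E4) F x w) =
              α x ![w]) ∧
        (∀ x : punctured p, x.1 ∈ (chartAt E4 q).source →
          ‖extChartAt (𝓡 4) q x.1 - extChartAt (𝓡 4) q q‖ = μ →
          0 < @inner ℝ E4 _ (mfderiv (𝓡 4) 𝓘(ℝ, E4) (fun z : punctured p => extChartAt (𝓡 4) q z.1) x (Z x))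
            (extChartAt (𝓡 4) q x.1 - extChartAt (𝓡 4) q q)) ∧
        (∀ x : punctured p, x.1 ∈ (chartAt E4 q).source →
          ‖extChartAt (𝓡 4) q x.1 - extChartAt (𝓡 4) q q‖ = μ →
          ∀ v : TangentSpace (𝓡 4) x,
            @inner ℝ E4 _ (mfderiv (𝓡 4) 𝓘(ℝ, E4) (fun z : punctured p => extChartAt (𝓡 4) q z.1) x v)
              (extChartAt (𝓡 4) q x.1 - extChartAt (𝓡 4) q q) = 0 →
            α x ![v] =
              Real.exp (u (A.symm (μ⁻¹ • (extChartAt (𝓡 4) q x.1 - extChartAt (𝓡 4) q q)))) *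
                (1 / 2 * stdSymplecticForm
                  (A.symm (μ⁻¹ • (extChartAt (𝓡 4) q x.1 - extChartAt (𝓡 4) q q)))
                  (A.symm (μ⁻¹ • (mfderiv (𝓡 4) 𝓘(ℝ, E4)
                    (fun z : punctured p => extChartAt (𝓡 4) q z.1) x v : E4))))) :=
  tightInnerSphereAt_of_nonempty_diffeomorph_sphere S
    (Summit.SmoothPoincare4.SmoothPoincare4.Theorems.SullivanDual.nonempty_diffeomorph_sphere_of_smoothPoincare4 h S) p

end Summit.SmoothPoincare4.SmoothPoincare4.Theorems.Target.KaehlerJacket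

end
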